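import Literature.NumberTheory.Rogawski1990.UnitStableOrbitalIntegralHSideValueTypeTwo      -- ★ type-(2) frame at `w`: `exists_rescaled_cyclicFrame`, `classOrbitalIntegral_indicator_eq_phiHtwo_of_not_exists_isRoot`
import Literature.NumberTheory.Automorphic.PlaneLatticesCompanionSelfDualLevelCount           -- ★ p845451 (T6-2): `ncard_selfDualStable_level_antidiag_companion_eq_sum`
import Literature.NumberTheory.Automorphic.SelfDualStableLatticeDepthCount                    -- ★ A-p13: `ncard_selfDualStable_level_congr`
import Literature.NumberTheory.Rogawski1990.UnitStableOrbitalIntegralHSideLevelValue          -- ★ p846028 (F3-1): `map_levelShift_le_iff_map_sub_smul_one_le`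
import Literature.NumberTheory.Rogawski1990.UnitStableOrbitalIntegralHSideLevelValueOfIsRoot  -- ★ p846210 (FILE A): `IsCanonical.exists_normalised`, `isCompact_and_interior_nonempty_prod_cmLocalIntegralLevel`
import Literature.NumberTheory.Automorphic.UnitaryLevelOrbitalIntegralLatticeCountPair        -- ★ p845908 (F2-H): `classOrbitalIntegral_level_prod_eq_ncard_selfDual_level`
import Literature.NumberTheory.Rogawski1990.UnitStableOrbitalIntegralIrredOneClass            -- ★ one class: `stableOrbitalIntegralRel_eq_classOrbitalIntegral_of_not_exists_isRoot`
import Literature.NumberTheory.Automorphic.CMLocalRankOneClassMapOpen                         -- ★ `placeForm_antidiagTwo_eq`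
import HarnessLib

/-!
# The TYPE-(2) H-side LEVEL values near the identity: `Φ^st(γ_H, 1_{K_H(j)}-class fn) = ν_H(K_H) · phiHtwo q (N − j)` (law «C1» on the anisotropic torus)

Topic `NumberTheory/Rogawski1990`; namespace `Literature.NumberTheory.Automorphic.UnitaryGroup`.  THEOREMS ONLY (no definition, no instance, no notation, no named fact,
no `sorry`).  Cell `pub/hodgecm-mathlib`, crux H413, road «S3-tree», brick **T6-2 ∕ O8c «H-values near 1», TYPE (2)** (the H-side of T3′ HEAD v4's clause
`depthZeroKappaTransfer_hyperspecial_typeTwo`; socket ★ p846003: «`Φ^st(χ₀) = ν_H(K_H)W₂(N−1)`, `Φ^st(χ₁) = ν_H(K_H)q^N`»); END∕T6 holder F0P3a-p03 (g15).  HC_CM is proved only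
modulo the cell's 2 remaining named inputs (hLiu418, h413) until rung 0 closes; this file is unconditional.

THE MATHEMATICS.  `γ_H = (g, u)` with `χ_{g,w}` IRREDUCIBLE over `L_w` (type (2)): the stable class is ONE `H_v`-class (★ `…_of_not_exists_isRoot`), `Z(g)` is the anisotropic
torus, and the self-dual `g`-stable lattices at `w` are the `Σ_{k ≤ N} q^k` vertices of the fixed ball about the `K₁`-point, `ord_w disc χ_g = 2N+1` [Flicker1998UnitaryFL,
p. 97].  At LEVEL `j` (`1 ≤ j ≤ N`, `g` deep: `tr g_w ≡ 2 (mod ϖ_w^j)`) the lattices on which `g` acts trivially mod `ϖ^j` number `Σ_{k ≤ N−j} q^k = phiHtwo q (N − j)`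
(★ p845451, the per-stratum law in the companion Hermite frame).  §1 instantiates ★ p845451 at the place `w` (twin of ★ `ncard_selfDualStable_antidiag_companion_eq_sum_at`);
§2 transports along the rescaled isotropic cyclic frame (★ `exists_rescaled_cyclicFrame`, ★ A-p13 `ncard_selfDualStable_level_congr` with the token bridge ★ F3-1
`map_levelShift_le_iff_map_sub_smul_one_le`); §3 reads it in the stub frame (`hint h2 hirr hN` + deepness); §4 is the per-class value through the ★ F2-H level socket
and the stable value for ANY Haar measure (one class; ★ FILE A `exists_normalised`).

* §1 `ncard_selfDualStable_level_antidiag_companion_eq_sum_at`.   §2 `ncard_selfDualStable_level_antidiagTwo_eq_sum_of_unitary`.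
* §3 `ncard_selfDualStable_level_antidiagTwo_eq_sum_of_not_exists_isRoot`.
* §4 `classOrbitalIntegral_level_eq_sum_of_not_exists_isRoot` (`ν_H(K_H) = 1`), **`stableOrbitalIntegralRel_level_eq_mul_phiHtwo_of_not_exists_isRoot`** (any Haar),
  **`stableOrbitalIntegralRel_indicator_eq_mul_phiHtwo_of_not_exists_isRoot`** (the unit, any Haar).

## References
* [Flicker1998UnitaryFL] Y. Z. Flicker, *Elementary proof of the fundamental lemma for a unitary group*, Canad. J. Math. 50 (1998), §6 p. 95 REMARK, p. 97.
* [Rogawski1990] J. D. Rogawski, *Automorphic Representations of Unitary Groups in Three Variables* (1990), §3.6 p. 31; §4.9 Prop. 4.9.1 (b) p. 55; §4.3 (4.3.1) p. 43.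
* [Kottwitz1988] R. E. Kottwitz, *Tamagawa numbers*, Ann. of Math. 127 (1988), §2.
* [Serre1979] J.-P. Serre, *Local Fields* (1979), Ch. V §2.
-/

set_option autoImplicit false

noncomputable section

open MeasureTheory Measure Set NumberField IsDedekindDomain Matrix Finset ValuativeRel
open scoped ENNReal NNReal ValuativeRel Matrix MatrixGroups

namespace Literature.NumberTheory.Automorphic.UnitaryGroup

open Literature.NumberTheory.Rogawski1990 Literature.NumberTheory.Automorphic

/-! ## §1 The normalised level-`j` type-(2) count at `w` -/

section AtPlace

variable (L : Type) [Field L] [NumberField L] [IsCMField L] (v : HeightOneSpectrum (𝓞 ↥(maximalRealSubfield L)))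
  (w : PlacesOver L v) (hw : IsCMField.complexConj L • w.1 = w.1)

include hw in
/-- **THE NORMALISED LEVEL-`j` TYPE-(2) COUNT AT `w`** — ★ p845451 `ncard_selfDualStable_level_antidiag_companion_eq_sum` at `F := L_w`, `σ := σ_w`, `ϖ := ι_w(ϖ_v)`: for
`t, d, β ∈ L_w` as in ★ `ncard_selfDualStable_antidiag_companion_eq_sum_at` and `1 ≤ j ≤ N`, `|t − 2| ≤ |ϖ^j|`:
`#{Λ ∈ S(!![0, β; σβ, 0], γ) : (1 + ϖ^{−j}(γ − 1))Λ ⊆ Λ} = Σ_(k ≤ N − j) q_v^k`. [cite: Flicker1998UnitaryFL, §6 p. 97] [cite: Serre1979, Ch. V §2] -/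
theorem ncard_selfDualStable_level_antidiag_companion_eq_sum_at (hunr : Algebra.IsUnramifiedIn (𝓞 L) v.asIdeal)
    (h2 : valuation (w.1.adicCompletion L) 2 = 1) {t d β : (w.1.adicCompletion L)} (ht : t ∈ 𝒪[(w.1.adicCompletion L)]) (hd : valuation (w.1.adicCompletion L) d = 1)
    {e : ℕ} (he : e ≤ 1) (hβ : valuation (w.1.adicCompletion L) β = valuation (w.1.adicCompletion L) ((toPlace v w (GaloisRepresentations.HeckeCharacter.uniformizer ↥(maximalRealSubfield L) v : v.adicCompletion ↥(maximalRealSubfield L))) ^ e)) {N : ℕ}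
    (hD : valuation (w.1.adicCompletion L) (t ^ 2 - 4 * d) = valuation (w.1.adicCompletion L) ((toPlace v w (GaloisRepresentations.HeckeCharacter.uniformizer ↥(maximalRealSubfield L) v : v.adicCompletion ↥(maximalRealSubfield L))) ^ (2 * N + 1)))
    (htr : β * (galAdicCompletionMap (L := L) (IsCMField.complexConj L) hw) t + (galAdicCompletionMap (L := L) (IsCMField.complexConj L) hw) β * t = 0)
    (γ : GL (Fin 2) (w.1.adicCompletion L)) (hγ : (γ : Matrix (Fin 2) (Fin 2) (w.1.adicCompletion L)) = !![0, -d; 1, t])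
    {j : ℕ} (hj : 1 ≤ j) (hjN : j ≤ N) (ht2 : valuation (w.1.adicCompletion L) (t - 2) ≤ valuation (w.1.adicCompletion L) ((toPlace v w (GaloisRepresentations.HeckeCharacter.uniformizer ↥(maximalRealSubfield L) v : v.adicCompletion ↥(maximalRealSubfield L))) ^ j)) :
    {Λ : Submodule 𝒪[(w.1.adicCompletion L)] (Fin 2 → (w.1.adicCompletion L)) |
        (∃ g : GL (Fin 2) (w.1.adicCompletion L), (∃ J' ∈ glInt 2 (w.1.adicCompletion L), (J' : Matrix (Fin 2) (Fin 2) (w.1.adicCompletion L)) =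
            formCongr (galAdicCompletionMap (L := L) (IsCMField.complexConj L) hw) g (!![0, β; (galAdicCompletionMap (L := L) (IsCMField.complexConj L) hw) β, 0] : Matrix (Fin 2) (Fin 2) (w.1.adicCompletion L))) ∧
          Λ = Submodule.span 𝒪[(w.1.adicCompletion L)] (Set.range ((g : Matrix (Fin 2) (Fin 2) (w.1.adicCompletion L)))ᵀ)) ∧
        Λ.map ((Matrix.toLin' (γ : Matrix (Fin 2) (Fin 2) (w.1.adicCompletion L))).restrictScalars 𝒪[(w.1.adicCompletion L)]) = Λ ∧
        Λ.map ((Matrix.toLin' (1 + ((toPlace v w (GaloisRepresentations.HeckeCharacter.uniformizer ↥(maximalRealSubfield L) v : v.adicCompletion ↥(maximalRealSubfield L))) ^ j)⁻¹ • ((γ : Matrix (Fin 2) (Fin 2) (w.1.adicCompletion L)) - 1))).restrictScalars 𝒪[(w.1.adicCompletion L)]) ≤ Λ}.ncard =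
      ∑ k ∈ range (N - j + 1), Nat.card (𝓞 ↥(maximalRealSubfield L) ⧸ v.asIdeal) ^ k := by
  classical
  have hc1 : IsCMField.complexConj L ≠ 1 := IsCMField.complexConj_ne_one L
  have hϖv := Liu2021.LemD1IndexedNonVacuityInertCofinite.valued_toPlace_uniformizer_of_isUnramifiedIn L v hunr w
  have hϖ : IsUniformizingElement (toPlace v w (GaloisRepresentations.HeckeCharacter.uniformizer ↥(maximalRealSubfield L) v : v.adicCompletion ↥(maximalRealSubfield L))) := isUniformizingElement_of_v_eq hϖv
  haveI : IsDiscreteValuationRing 𝒪[(w.1.adicCompletion L)] := isDiscreteValuationRing_integer_of_compatible hϖv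
  have hσO : ∀ x : 𝒪[(w.1.adicCompletion L)], (galAdicCompletionMap (L := L) (IsCMField.complexConj L) hw) x ∈ 𝒪[(w.1.adicCompletion L)] := mem_integer_galAdicCompletionMap (IsCMField.complexConj L) v w hw
  let σO : 𝒪[(w.1.adicCompletion L)] →+* 𝒪[(w.1.adicCompletion L)] := ((galAdicCompletionMap (L := L) (IsCMField.complexConj L) hw).comp (𝒪[(w.1.adicCompletion L)]).subtype).codRestrict 𝒪[(w.1.adicCompletion L)] fun x => hσO x
  have hσO' : ∀ x : 𝒪[(w.1.adicCompletion L)], ((σO x : 𝒪[(w.1.adicCompletion L)]) : (w.1.adicCompletion L)) = (galAdicCompletionMap (L := L) (IsCMField.complexConj L) hw) x := fun _ => rfl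
  have hσσ : ∀ x, σO (σO x) = x := fun x =>
    Subtype.ext (galAdicCompletionMap_galAdicCompletionMap_of_smul_eq (IsCMField.complexConj L) w hc1 hw (x : (w.1.adicCompletion L)))
  have hσϖ : (galAdicCompletionMap (L := L) (IsCMField.complexConj L) hw) (toPlace v w (GaloisRepresentations.HeckeCharacter.uniformizer ↥(maximalRealSubfield L) v : v.adicCompletion ↥(maximalRealSubfield L))) = (toPlace v w (GaloisRepresentations.HeckeCharacter.uniformizer ↥(maximalRealSubfield L) v : v.adicCompletion ↥(maximalRealSubfield L))) := galAdicCompletionMap_toPlace (IsCMField.complexConj L) w w hw _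
  have hσv : ∀ x, valuation (w.1.adicCompletion L) ((galAdicCompletionMap (L := L) (IsCMField.complexConj L) hw) x) = valuation (w.1.adicCompletion L) x := fun x => valuation_galAdicCompletionMap_eq (IsCMField.complexConj L) v w hw x
  obtain ⟨σk, hσk⟩ := exists_residueField_ringHom_galAdicCompletionMap (IsCMField.complexConj L) v w hw
  have hq : Nat.card 𝓀[(w.1.adicCompletion L)] = Nat.card (𝓞 ↥(maximalRealSubfield L) ⧸ v.asIdeal) ^ 2 := natCard_residueField_eq_sq_of_inert (IsCMField.complexConj L) v hc1 hunr w hw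
  letI : Fintype 𝓀[(w.1.adicCompletion L)] := Fintype.ofFinite _
  have hq' : Fintype.card 𝓀[(w.1.adicCompletion L)] = Nat.card (𝓞 ↥(maximalRealSubfield L) ⧸ v.asIdeal) ^ 2 := by rw [← Nat.card_eq_fintype_card, hq]
  obtain ⟨a₀, ha₀⟩ := LocalFields.UnramifiedQuadraticNorm.exists_isUnit_map_sub_of_residueHom_ne (galAdicCompletionMap (L := L) (IsCMField.complexConj L) hw) hσO σk hσk
    (Literature.LinearAlgebra.Matrix.exists_frob_ne hq' σk (residueHom_galAdicCompletionMap_eq_pow (IsCMField.complexConj L) v hc1 hunr w hw σk hσO hσk))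
  have ha₀' : IsUnit (σO a₀ - a₀) := ha₀
  exact ncard_selfDualStable_level_antidiag_companion_eq_sum hϖ (galAdicCompletionMap (L := L) (IsCMField.complexConj L) hw) σO hσO' hσσ hσϖ hσv h2 ht hd he hβ hD htr γ hγ hj hjN ht2 hq ha₀'

end AtPlace

/-! ## §2–§3 The frame at the place `w` and the level count in the stub frame -/

section Value

variable (L : Type) [Field L] [NumberField L] [IsCMField L] (v : HeightOneSpectrum (𝓞 ↥(maximalRealSubfield L)))
  (w : PlacesOver L v) (hw : IsCMField.complexConj L • w.1 = w.1)

set_option maxHeartbeats 400000 in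
include hw in
/-- **THE LEVEL-`j` COUNT AT THE PLACE `w` FOR A UNITARY MATRIX WITHOUT EIGENVALUES IN `L_w`** (pure `L_w` statement): for `g ∈ GL₂(L_w)` unitary for
`(Φ₂)_w = !![0,1;1,0]`, `χ_g` without root in `L_w`, `tr g ∈ 𝒪`, `|2| = 1`, `|tr² − 4 det| = exp(−(2N+1))`, `1 ≤ j ≤ N`, `|tr g − 2| ≤ |ϖ^j|`:
`#{Λ ∈ S((Φ₂)_w, g) : (1 + ϖ^{−j}(g − 1))Λ ⊆ Λ} = Σ_(k ≤ N − j) q_v^k` — the rescaled isotropic cyclic frame (★ `exists_rescaled_cyclicFrame`), the LEVEL frame transport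
(★ A-p13 `ncard_selfDualStable_level_congr`, tokens bridged by ★ F3-1 `map_levelShift_le_iff_map_sub_smul_one_le` at `s = 1`), §1.
[cite: Flicker1998UnitaryFL, §6 p. 97] [cite: Rogawski1990, §3.6 p. 31] [cite: Kottwitz1988, §2] -/
theorem ncard_selfDualStable_level_antidiagTwo_eq_sum_of_unitary (hunr : Algebra.IsUnramifiedIn (𝓞 L) v.asIdeal)
    (gGL : GL (Fin 2) (w.1.adicCompletion L)) (g : Matrix (Fin 2) (Fin 2) (w.1.adicCompletion L)) (hcoe : (gGL : Matrix (Fin 2) (Fin 2) (w.1.adicCompletion L)) = g)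
    (hgU : (g.map (galAdicCompletionMap (L := L) (IsCMField.complexConj L) hw))ᵀ * (!![0, 1; 1, 0] : Matrix (Fin 2) (Fin 2) (w.1.adicCompletion L)) * g = !![0, 1; 1, 0])
    (h2v : valuation (w.1.adicCompletion L) 2 = 1) (ht : g.trace ∈ 𝒪[(w.1.adicCompletion L)])
    (hirr : ¬ ∃ x : (w.1.adicCompletion L), (g.charpoly).IsRoot x)
    (N : ℕ) (hN : Valued.v (g.trace ^ 2 - 4 * g.det) = WithZero.exp (-((2 * N + 1 : ℕ) : ℤ)))
    {j : ℕ} (hj : 1 ≤ j) (hjN : j ≤ N) (ht2 : valuation (w.1.adicCompletion L) (g.trace - 2) ≤ valuation (w.1.adicCompletion L) ((toPlace v w (GaloisRepresentations.HeckeCharacter.uniformizer ↥(maximalRealSubfield L) v : v.adicCompletion ↥(maximalRealSubfield L))) ^ j)) :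
    {Λ : Submodule 𝒪[(w.1.adicCompletion L)] (Fin 2 → (w.1.adicCompletion L)) |
        (∃ g' : GL (Fin 2) (w.1.adicCompletion L), (∃ J' ∈ glInt 2 (w.1.adicCompletion L), (J' : Matrix (Fin 2) (Fin 2) (w.1.adicCompletion L)) =
            formCongr (galAdicCompletionMap (L := L) (IsCMField.complexConj L) hw) g' (placeForm (Matrix.of fun i j : Fin 2 => if i.val + j.val + 1 = 2 then (1 : L) else 0) w.1)) ∧
          Λ = Submodule.span 𝒪[(w.1.adicCompletion L)] (Set.range ((g' : Matrix (Fin 2) (Fin 2) (w.1.adicCompletion L)))ᵀ)) ∧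
        Λ.map ((Matrix.toLin' ((gGL : GL (Fin 2) (w.1.adicCompletion L)) : Matrix (Fin 2) (Fin 2) (w.1.adicCompletion L))).restrictScalars 𝒪[(w.1.adicCompletion L)]) = Λ ∧
        Λ.map ((Matrix.toLin' (1 + ((toPlace v w (GaloisRepresentations.HeckeCharacter.uniformizer ↥(maximalRealSubfield L) v : v.adicCompletion ↥(maximalRealSubfield L))) ^ j)⁻¹ • (((gGL : GL (Fin 2) (w.1.adicCompletion L)) : Matrix (Fin 2) (Fin 2) (w.1.adicCompletion L)) - 1))).restrictScalars 𝒪[(w.1.adicCompletion L)]) ≤ Λ}.ncard =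
      ∑ k ∈ range (N - j + 1), Nat.card (𝓞 ↥(maximalRealSubfield L) ⧸ v.asIdeal) ^ k := by
  classical
  have hc1 : IsCMField.complexConj L ≠ 1 := IsCMField.complexConj_ne_one L
  have hϖv := Liu2021.LemD1IndexedNonVacuityInertCofinite.valued_toPlace_uniformizer_of_isUnramifiedIn L v hunr w
  have hϖ : IsUniformizingElement (toPlace v w (GaloisRepresentations.HeckeCharacter.uniformizer ↥(maximalRealSubfield L) v : v.adicCompletion ↥(maximalRealSubfield L))) := isUniformizingElement_of_v_eq hϖv
  have h0 := hϖ.ne_zero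
  haveI : IsDiscreteValuationRing 𝒪[(w.1.adicCompletion L)] := isDiscreteValuationRing_integer_of_compatible hϖv
  have hσv : ∀ x, valuation (w.1.adicCompletion L) ((galAdicCompletionMap (L := L) (IsCMField.complexConj L) hw) x) = valuation (w.1.adicCompletion L) x := fun x => valuation_galAdicCompletionMap_eq (IsCMField.complexConj L) v w hw x
  have hσϖ : (galAdicCompletionMap (L := L) (IsCMField.complexConj L) hw) (toPlace v w (GaloisRepresentations.HeckeCharacter.uniformizer ↥(maximalRealSubfield L) v : v.adicCompletion ↥(maximalRealSubfield L))) = (toPlace v w (GaloisRepresentations.HeckeCharacter.uniformizer ↥(maximalRealSubfield L) v : v.adicCompletion ↥(maximalRealSubfield L))) := galAdicCompletionMap_toPlace (IsCMField.complexConj L) w w hw _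
  -- `g₁₀ ≠ 0` (else `g₀₀` is a root of `χ_g`)
  have hg10 : g 1 0 ≠ 0 := fun h10 => hirr ⟨g 0 0, by
    rw [Polynomial.IsRoot, Matrix.charpoly_fin_two, Matrix.trace_fin_two, Matrix.det_fin_two, h10]
    simp; ring⟩
  -- rescaling exponent: `|g₁₀| = |ϖ^m|`, `m = 2r + e`
  obtain ⟨m, hm⟩ := exists_valuation_eq_valuation_zpow hϖ hg10
  obtain ⟨r, e, he, hme⟩ : ∃ (r : ℤ) (e : ℕ), e ≤ 1 ∧ m = 2 * r + e := ⟨m / 2, (m % 2).toNat, by omega, by omega⟩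
  obtain ⟨a, ha⟩ : ∃ a : (w.1.adicCompletion L), (toPlace v w (GaloisRepresentations.HeckeCharacter.uniformizer ↥(maximalRealSubfield L) v : v.adicCompletion ↥(maximalRealSubfield L))) ^ (-r) = a := ⟨_, rfl⟩
  have ha0 : a ≠ 0 := by rw [← ha]; exact zpow_ne_zero _ h0
  have hσa : (galAdicCompletionMap (L := L) (IsCMField.complexConj L) hw) a = a := by rw [← ha, map_zpow₀, hσϖ]
  -- the rescaled isotropic cyclic frame
  obtain ⟨P', hC', hform', hdβ, htr⟩ := exists_rescaled_cyclicFrame (galAdicCompletionMap (L := L) (IsCMField.complexConj L) hw) gGL g hcoe hgU hg10 ha0 hσa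
  -- valuations
  have hdv : valuation (w.1.adicCompletion L) g.det = 1 := by
    have h := congrArg (valuation (w.1.adicCompletion L)) hdβ
    rw [map_mul, Valuation.map_neg, hσv] at h
    exact mul_right_cancel₀ ((Valuation.ne_zero_iff _).2 hg10) (h.trans (one_mul _).symm)
  have hD : valuation (w.1.adicCompletion L) (g.trace ^ 2 - 4 * g.det) = valuation (w.1.adicCompletion L) ((toPlace v w (GaloisRepresentations.HeckeCharacter.uniformizer ↥(maximalRealSubfield L) v : v.adicCompletion ↥(maximalRealSubfield L))) ^ (2 * N + 1)) := by
    refine (v_eq_iff_valuation_eq _ _).1 ?_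
    rw [hN, map_pow, hϖv, ← WithZero.exp_nsmul]
    simp
  have hβ' : valuation (w.1.adicCompletion L) (a ^ 2 * g 1 0) = valuation (w.1.adicCompletion L) ((toPlace v w (GaloisRepresentations.HeckeCharacter.uniformizer ↥(maximalRealSubfield L) v : v.adicCompletion ↥(maximalRealSubfield L))) ^ e) := by
    rw [map_mul, hm, ← map_mul, ← ha, ← zpow_natCast ((toPlace v w (GaloisRepresentations.HeckeCharacter.uniformizer ↥(maximalRealSubfield L) v : v.adicCompletion ↥(maximalRealSubfield L))) ^ (-r)), ← _root_.zpow_mul, ← zpow_add₀ h0, ← zpow_natCast]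
    congr 2; push_cast; omega
  have htr' : a ^ 2 * g 1 0 * (galAdicCompletionMap (L := L) (IsCMField.complexConj L) hw) g.trace + (galAdicCompletionMap (L := L) (IsCMField.complexConj L) hw) (a ^ 2 * g 1 0) * g.trace = 0 := by
    rw [map_mul, map_pow, hσa]
    linear_combination a ^ 2 * htr
  -- the level tokens: `(1 + ϖ^{−j}(x − 1))Λ ⊆ Λ ↔ (x − 1)Λ ⊆ ϖ^jΛ` on fixed lattices `Λ = Λ(g')` (★ F3-1 §1 at `s = 1`)
  have hs1 : valuation (w.1.adicCompletion L) ((1 : (w.1.adicCompletion L)) - 1) ≤ valuation (w.1.adicCompletion L) ((toPlace v w (GaloisRepresentations.HeckeCharacter.uniformizer ↥(maximalRealSubfield L) v : v.adicCompletion ↥(maximalRealSubfield L))) ^ j) := by rw [sub_self, map_zero]; exact zero_le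
  have hbridge : ∀ (J : Matrix (Fin 2) (Fin 2) (w.1.adicCompletion L)) (x : GL (Fin 2) (w.1.adicCompletion L)),
      {Λ : Submodule 𝒪[(w.1.adicCompletion L)] (Fin 2 → (w.1.adicCompletion L)) |
        (∃ g' : GL (Fin 2) (w.1.adicCompletion L), (∃ J' ∈ glInt 2 (w.1.adicCompletion L), (J' : Matrix (Fin 2) (Fin 2) (w.1.adicCompletion L)) = formCongr (galAdicCompletionMap (L := L) (IsCMField.complexConj L) hw) g' J) ∧
          Λ = Submodule.span 𝒪[(w.1.adicCompletion L)] (Set.range ((g' : Matrix (Fin 2) (Fin 2) (w.1.adicCompletion L)))ᵀ)) ∧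
        Λ.map ((Matrix.toLin' ((x : GL (Fin 2) (w.1.adicCompletion L)) : Matrix (Fin 2) (Fin 2) (w.1.adicCompletion L))).restrictScalars 𝒪[(w.1.adicCompletion L)]) = Λ ∧
        Λ.map ((Matrix.toLin' (1 + ((toPlace v w (GaloisRepresentations.HeckeCharacter.uniformizer ↥(maximalRealSubfield L) v : v.adicCompletion ↥(maximalRealSubfield L))) ^ j)⁻¹ • (((x : GL (Fin 2) (w.1.adicCompletion L)) : Matrix (Fin 2) (Fin 2) (w.1.adicCompletion L)) - 1))).restrictScalars 𝒪[(w.1.adicCompletion L)]) ≤ Λ} =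
      {Λ : Submodule 𝒪[(w.1.adicCompletion L)] (Fin 2 → (w.1.adicCompletion L)) |
        ((∃ g' : GL (Fin 2) (w.1.adicCompletion L), (∃ J' ∈ glInt 2 (w.1.adicCompletion L), (J' : Matrix (Fin 2) (Fin 2) (w.1.adicCompletion L)) = formCongr (galAdicCompletionMap (L := L) (IsCMField.complexConj L) hw) g' J) ∧
            Λ = Submodule.span 𝒪[(w.1.adicCompletion L)] (Set.range ((g' : Matrix (Fin 2) (Fin 2) (w.1.adicCompletion L)))ᵀ)) ∧
          Λ.map ((Matrix.toLin' ((x : GL (Fin 2) (w.1.adicCompletion L)) : Matrix (Fin 2) (Fin 2) (w.1.adicCompletion L))).restrictScalars 𝒪[(w.1.adicCompletion L)]) = Λ) ∧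
        Λ.map ((Matrix.toLin' (((x : GL (Fin 2) (w.1.adicCompletion L)) : Matrix (Fin 2) (Fin 2) (w.1.adicCompletion L)) - (1 : (w.1.adicCompletion L)) • (1 : Matrix (Fin 2) (Fin 2) (w.1.adicCompletion L)))).restrictScalars 𝒪[(w.1.adicCompletion L)]) ≤
          Λ.map ((Matrix.toLin' ((toPlace v w (GaloisRepresentations.HeckeCharacter.uniformizer ↥(maximalRealSubfield L) v : v.adicCompletion ↥(maximalRealSubfield L))) ^ j • (1 : Matrix (Fin 2) (Fin 2) (w.1.adicCompletion L)))).restrictScalars 𝒪[(w.1.adicCompletion L)])} := by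
    intro J x
    ext Λ
    simp only [Set.mem_setOf_eq]
    constructor
    · rintro ⟨⟨g', hJ, rfl⟩, hst, hlev⟩
      exact ⟨⟨⟨g', hJ, rfl⟩, hst⟩, (map_levelShift_le_iff_map_sub_smul_one_le hϖ hj x g' hs1 hst).1 hlev⟩
    · rintro ⟨⟨⟨g', hJ, rfl⟩, hst⟩, hlev⟩
      exact ⟨⟨g', hJ, rfl⟩, hst, (map_levelShift_le_iff_map_sub_smul_one_le hϖ hj x g' hs1 hst).2 hlev⟩
  -- transport along `P'` (★ A-p13 LEVEL frame transport) and count (§1)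
  rw [hbridge, ncard_selfDualStable_level_congr (galAdicCompletionMap (L := L) (IsCMField.complexConj L) hw) (placeForm (Matrix.of fun i j : Fin 2 => if i.val + j.val + 1 = 2 then (1 : L) else 0) w.1) gGL P' 1 ((toPlace v w (GaloisRepresentations.HeckeCharacter.uniformizer ↥(maximalRealSubfield L) v : v.adicCompletion ↥(maximalRealSubfield L))) ^ j),
    placeForm_antidiagTwo_eq L v w, hform', ← hbridge]
  exact ncard_selfDualStable_level_antidiag_companion_eq_sum_at L v w hw hunr h2v ht hdv he hβ' hD htr' _ hC' hj hjN ht2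

set_option maxHeartbeats 400000 in
include hw in
/-- **THE LEVEL-`j` COUNT AT THE PLACE `w` FOR A TYPE-(2) ELEMENT** `γ₂ ∈ U(Φ₂)(L⁺_v)` in the stub frame (`hint`, `h2`, `hirr` at `w`, `hN`) plus deepness
`|tr(γ₂)_w − 2| ≤ exp(−j)`, `1 ≤ j ≤ N`: `#{Λ ∈ S((Φ₂)_w, (γ₂)_w) : (1 + ϖ^{−j}((γ₂)_w − 1))Λ ⊆ Λ} = Σ_(k ≤ N − j) q_v^k`.
[cite: Flicker1998UnitaryFL, §6 p. 97] [cite: Rogawski1990, §3.6 p. 31] [cite: Kottwitz1988, §2] -/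
theorem ncard_selfDualStable_level_antidiagTwo_eq_sum_of_not_exists_isRoot (hunr : Algebra.IsUnramifiedIn (𝓞 L) v.asIdeal)
    (γH : (cmDatum L 2 (Matrix.of fun i j : Fin 2 => if i.val + j.val + 1 = 2 then (1 : L) else 0)).Local v × (cmDatum L 1 (Matrix.of fun i j : Fin 1 => if i.val + j.val + 1 = 1 then (1 : L) else 0)).Local v) (h2 : IsUnit (2 : 𝒪[(w.1.adicCompletion L)]))
    (hint : ∀ i : ℕ, ((((endoEmbLocal L v γH).val : GL (Fin 3) (LocalRing L v)).val.map (Pi.evalRingHom (fun w' : PlacesOver L v => w'.1.adicCompletion L) w)).charpoly.coeff i) ∈ 𝒪[(w.1.adicCompletion L)])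
    (hirr : ¬ ∃ x : (w.1.adicCompletion L), (((((γH).1.val : GL (Fin 2) (UnitaryGroup.LocalRing L v)).val.map (Pi.evalRingHom (fun w' : PlacesOver L v => w'.1.adicCompletion L) w))).charpoly).IsRoot x)
    (N : ℕ) (hN : Valued.v (((((γH).1.val : GL (Fin 2) (UnitaryGroup.LocalRing L v)).val.map (Pi.evalRingHom (fun w' : PlacesOver L v => w'.1.adicCompletion L) w))).trace ^ 2 - 4 * ((((γH).1.val : GL (Fin 2) (UnitaryGroup.LocalRing L v)).val.map (Pi.evalRingHom (fun w' : PlacesOver L v => w'.1.adicCompletion L) w))).det) = WithZero.exp (-((2 * N + 1 : ℕ) : ℤ)))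
    {j : ℕ} (hj : 1 ≤ j) (hjN : j ≤ N) (ht2 : Valued.v (((((γH).1.val : GL (Fin 2) (UnitaryGroup.LocalRing L v)).val.map (Pi.evalRingHom (fun w' : PlacesOver L v => w'.1.adicCompletion L) w))).trace - 2) ≤ WithZero.exp (-(j : ℤ))) :
    {Λ : Submodule 𝒪[(w.1.adicCompletion L)] (Fin 2 → (w.1.adicCompletion L)) |
        (∃ g : GL (Fin 2) (w.1.adicCompletion L), (∃ J' ∈ glInt 2 (w.1.adicCompletion L), (J' : Matrix (Fin 2) (Fin 2) (w.1.adicCompletion L)) =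
            formCongr (galAdicCompletionMap (L := L) (IsCMField.complexConj L) hw) g (placeForm (Matrix.of fun i j : Fin 2 => if i.val + j.val + 1 = 2 then (1 : L) else 0) w.1)) ∧
          Λ = Submodule.span 𝒪[(w.1.adicCompletion L)] (Set.range ((g : Matrix (Fin 2) (Fin 2) (w.1.adicCompletion L)))ᵀ)) ∧
        Λ.map ((Matrix.toLin' ((((localNonsplitEquiv (IsCMField.complexConj L) (Matrix.of fun i j : Fin 2 => if i.val + j.val + 1 = 2 then (1 : L) else 0) (IsCMField.complexConj_ne_one L) w hw) (γH).1 : ↥(unitaryGroupOfForm (galAdicCompletionMap (L := L) (IsCMField.complexConj L) hw) (placeForm (Matrix.of fun i j : Fin 2 => if i.val + j.val + 1 = 2 then (1 : L) else 0) w.1))) : GL (Fin 2) (w.1.adicCompletion L)) : Matrix (Fin 2) (Fin 2) (w.1.adicCompletion L))).restrictScalars 𝒪[(w.1.adicCompletion L)]) = Λ ∧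
        Λ.map ((Matrix.toLin' (1 + ((toPlace v w (GaloisRepresentations.HeckeCharacter.uniformizer ↥(maximalRealSubfield L) v : v.adicCompletion ↥(maximalRealSubfield L))) ^ j)⁻¹ • (((((localNonsplitEquiv (IsCMField.complexConj L) (Matrix.of fun i j : Fin 2 => if i.val + j.val + 1 = 2 then (1 : L) else 0) (IsCMField.complexConj_ne_one L) w hw) (γH).1 : ↥(unitaryGroupOfForm (galAdicCompletionMap (L := L) (IsCMField.complexConj L) hw) (placeForm (Matrix.of fun i j : Fin 2 => if i.val + j.val + 1 = 2 then (1 : L) else 0) w.1))) : GL (Fin 2) (w.1.adicCompletion L)) : Matrix (Fin 2) (Fin 2) (w.1.adicCompletion L)) - 1))).restrictScalars 𝒪[(w.1.adicCompletion L)]) ≤ Λ}.ncard =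
      ∑ k ∈ range (N - j + 1), Nat.card (𝓞 ↥(maximalRealSubfield L) ⧸ v.asIdeal) ^ k := by
  have hcoe : ((((localNonsplitEquiv (IsCMField.complexConj L) (Matrix.of fun i j : Fin 2 => if i.val + j.val + 1 = 2 then (1 : L) else 0) (IsCMField.complexConj_ne_one L) w hw) (γH).1 : ↥(unitaryGroupOfForm (galAdicCompletionMap (L := L) (IsCMField.complexConj L) hw) (placeForm (Matrix.of fun i j : Fin 2 => if i.val + j.val + 1 = 2 then (1 : L) else 0) w.1))) : GL (Fin 2) (w.1.adicCompletion L)) : Matrix (Fin 2) (Fin 2) (w.1.adicCompletion L)) = (((γH).1.val : GL (Fin 2) (UnitaryGroup.LocalRing L v)).val.map (Pi.evalRingHom (fun w' : PlacesOver L v => w'.1.adicCompletion L) w)) := coe_localNonsplitEquiv_apply L (Matrix.of fun i j : Fin 2 => if i.val + j.val + 1 = 2 then (1 : L) else 0) v w hw γH.1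
  have hgU : (((((γH).1.val : GL (Fin 2) (UnitaryGroup.LocalRing L v)).val.map (Pi.evalRingHom (fun w' : PlacesOver L v => w'.1.adicCompletion L) w))).map (galAdicCompletionMap (L := L) (IsCMField.complexConj L) hw))ᵀ * (!![0, 1; 1, 0] : Matrix (Fin 2) (Fin 2) (w.1.adicCompletion L)) * (((γH).1.val : GL (Fin 2) (UnitaryGroup.LocalRing L v)).val.map (Pi.evalRingHom (fun w' : PlacesOver L v => w'.1.adicCompletion L) w)) = !![0, 1; 1, 0] := by
    rw [← hcoe, ← placeForm_antidiagTwo_eq L v w]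
    exact (mem_unitaryGroupOfForm_iff (σ := (galAdicCompletionMap (L := L) (IsCMField.complexConj L) hw)) (J := placeForm (Matrix.of fun i j : Fin 2 => if i.val + j.val + 1 = 2 then (1 : L) else 0) w.1) (g := ((localNonsplitEquiv (IsCMField.complexConj L) (Matrix.of fun i j : Fin 2 => if i.val + j.val + 1 = 2 then (1 : L) else 0) (IsCMField.complexConj_ne_one L) w hw (γH).1 : ↥(unitaryGroupOfForm (galAdicCompletionMap (L := L) (IsCMField.complexConj L) hw) (placeForm (Matrix.of fun i j : Fin 2 => if i.val + j.val + 1 = 2 then (1 : L) else 0) w.1))) : GL (Fin 2) (w.1.adicCompletion L)))).1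
      ((localNonsplitEquiv (IsCMField.complexConj L) (Matrix.of fun i j : Fin 2 => if i.val + j.val + 1 = 2 then (1 : L) else 0) (IsCMField.complexConj_ne_one L) w hw γH.1 :
        unitaryGroupOfForm (galAdicCompletionMap (L := L) (IsCMField.complexConj L) hw) (placeForm (Matrix.of fun i j : Fin 2 => if i.val + j.val + 1 = 2 then (1 : L) else 0) w.1))).2
  obtain ⟨htv, -⟩ := valued_trace_le_one_and_valued_det_le_one_of_hint L v w hw (a := γH)
    (fun i => by rw [valuedInteger_eq_integer]; exact hint i)
  have ht : ((((γH).1.val : GL (Fin 2) (UnitaryGroup.LocalRing L v)).val.map (Pi.evalRingHom (fun w' : PlacesOver L v => w'.1.adicCompletion L) w))).trace ∈ 𝒪[(w.1.adicCompletion L)] := (v_le_one_iff_mem_integer _).1 htv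
  have h2v : valuation (w.1.adicCompletion L) 2 = 1 := by
    have := (Valuation.integer.integers (valuation (w.1.adicCompletion L))).isUnit_iff_valuation_eq_one.1 h2
    rwa [map_ofNat] at this
  have hϖv := Liu2021.LemD1IndexedNonVacuityInertCofinite.valued_toPlace_uniformizer_of_isUnramifiedIn L v hunr w
  have ht2' : valuation (w.1.adicCompletion L) (((((γH).1.val : GL (Fin 2) (UnitaryGroup.LocalRing L v)).val.map (Pi.evalRingHom (fun w' : PlacesOver L v => w'.1.adicCompletion L) w))).trace - 2) ≤ valuation (w.1.adicCompletion L) ((toPlace v w (GaloisRepresentations.HeckeCharacter.uniformizer ↥(maximalRealSubfield L) v : v.adicCompletion ↥(maximalRealSubfield L))) ^ j) := by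
    refine (v_le_iff_valuation_le _ _).1 ?_
    rw [map_pow, hϖv, ← WithZero.exp_nsmul]
    simpa using ht2
  exact ncard_selfDualStable_level_antidiagTwo_eq_sum_of_unitary L v w hw hunr _ _ hcoe hgU h2v ht hirr N hN hj hjN ht2'

end Value

/-! ## §4 The per-class level value (`ν_H(K_H) = 1`) and the stable values for ANY Haar measure -/

section Head

variable (L : Type) [Field L] [NumberField L] [IsCMField L] (v : HeightOneSpectrum (𝓞 ↥(maximalRealSubfield L)))
  (w : PlacesOver L v) (hw : IsCMField.complexConj L • w.1 = w.1)
  [MeasurableSpace ((cmDatum L 2 (Matrix.of fun i j : Fin 2 => if i.val + j.val + 1 = 2 then (1 : L) else 0)).Local v × (cmDatum L 1 (Matrix.of fun i j : Fin 1 => if i.val + j.val + 1 = 1 then (1 : L) else 0)).Local v)] [BorelSpace ((cmDatum L 2 (Matrix.of fun i j : Fin 2 => if i.val + j.val + 1 = 2 then (1 : L) else 0)).Local v × (cmDatum L 1 (Matrix.of fun i j : Fin 1 => if i.val + j.val + 1 = 1 then (1 : L) else 0)).Local v)]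
  [∀ a : (cmDatum L 2 (Matrix.of fun i j : Fin 2 => if i.val + j.val + 1 = 2 then (1 : L) else 0)).Local v × (cmDatum L 1 (Matrix.of fun i j : Fin 1 => if i.val + j.val + 1 = 1 then (1 : L) else 0)).Local v, MeasurableSpace (((cmDatum L 2 (Matrix.of fun i j : Fin 2 => if i.val + j.val + 1 = 2 then (1 : L) else 0)).Local v × (cmDatum L 1 (Matrix.of fun i j : Fin 1 => if i.val + j.val + 1 = 1 then (1 : L) else 0)).Local v) ⧸ Subgroup.centralizer ({a} : Set ((cmDatum L 2 (Matrix.of fun i j : Fin 2 => if i.val + j.val + 1 = 2 then (1 : L) else 0)).Local v × (cmDatum L 1 (Matrix.of fun i j : Fin 1 => if i.val + j.val + 1 = 1 then (1 : L) else 0)).Local v)))]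
  [∀ a : (cmDatum L 2 (Matrix.of fun i j : Fin 2 => if i.val + j.val + 1 = 2 then (1 : L) else 0)).Local v × (cmDatum L 1 (Matrix.of fun i j : Fin 1 => if i.val + j.val + 1 = 1 then (1 : L) else 0)).Local v, BorelSpace (((cmDatum L 2 (Matrix.of fun i j : Fin 2 => if i.val + j.val + 1 = 2 then (1 : L) else 0)).Local v × (cmDatum L 1 (Matrix.of fun i j : Fin 1 => if i.val + j.val + 1 = 1 then (1 : L) else 0)).Local v) ⧸ Subgroup.centralizer ({a} : Set ((cmDatum L 2 (Matrix.of fun i j : Fin 2 => if i.val + j.val + 1 = 2 then (1 : L) else 0)).Local v × (cmDatum L 1 (Matrix.of fun i j : Fin 1 => if i.val + j.val + 1 = 1 then (1 : L) else 0)).Local v)))]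
  (νH : Measure ((cmDatum L 2 (Matrix.of fun i j : Fin 2 => if i.val + j.val + 1 = 2 then (1 : L) else 0)).Local v × (cmDatum L 1 (Matrix.of fun i j : Fin 1 => if i.val + j.val + 1 = 1 then (1 : L) else 0)).Local v)) [νH.IsHaarMeasure] [νH.IsMulRightInvariant]

omit [IsCMField L] in
/-- `2 ≤ q_v`. [cite: Rogawski1990, §4.9 p. 54] -/
private theorem two_le_natCard_quotient : 2 ≤ Nat.card (𝓞 ↥(maximalRealSubfield L) ⧸ v.asIdeal) := by
  classical
  haveI : Finite (𝓞 ↥(maximalRealSubfield L) ⧸ v.asIdeal) := Ideal.finiteQuotientOfFreeOfNeBot v.asIdeal v.ne_bot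
  haveI : Nontrivial (𝓞 ↥(maximalRealSubfield L) ⧸ v.asIdeal) := Ideal.Quotient.nontrivial_iff.2 v.isPrime.ne_top
  exact Finite.one_lt_card

set_option maxHeartbeats 400000 in
include hw in
/-- **THE PER-CLASS LEVEL-`j` VALUE, TYPE (2)** (`ν_H(K_H) = 1`): `Φ(⟦γ_H⟧, f) = Σ_(k ≤ N − j) q_v^k` for `f` the level-`ϖ_w^j` class function on `K_H` (★ F2-H spelling),
`γ_H = (γ₂, γ₁)` `G`-regular of type (2) in the stub frame (`hint h2 hirr hN`, `[CompactSpace Z(γ₂)]`) and deep (`|tr(γ₂)_w − 2| ≤ exp(−j)`, `1 ≤ j ≤ N`):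
★ F2-H `classOrbitalIntegral_level_prod_eq_ncard_selfDual_level` ∘ §3. [cite: Flicker1998UnitaryFL, §6 p. 97] [cite: Rogawski1990, §4.9 Prop. 4.9.1 (b) p. 55] -/
theorem classOrbitalIntegral_level_eq_sum_of_not_exists_isRoot (hunr : Algebra.IsUnramifiedIn (𝓞 L) v.asIdeal)
    {mH : OrbitalMeasureFamily ((cmDatum L 2 (Matrix.of fun i j : Fin 2 => if i.val + j.val + 1 = 2 then (1 : L) else 0)).Local v × (cmDatum L 1 (Matrix.of fun i j : Fin 1 => if i.val + j.val + 1 = 1 then (1 : L) else 0)).Local v)} (hmH : mH.IsCanonical (IsLocalGRegular L v) νH) (hνH : νH ((((cmLocalIntegralLevel L 2 (Matrix.of fun i j : Fin 2 => if i.val + j.val + 1 = 2 then (1 : L) else 0) v).prod (cmLocalIntegralLevel L 1 (Matrix.of fun i j : Fin 1 => if i.val + j.val + 1 = 1 then (1 : L) else 0) v)) : Subgroup ((cmDatum L 2 (Matrix.of fun i j : Fin 2 => if i.val + j.val + 1 = 2 then (1 : L) else 0)).Local v × (cmDatum L 1 (Matrix.of fun i j : Fin 1 => if i.val + j.val + 1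 = 1 then (1 : L) else 0)).Local v)) : Set ((cmDatum L 2 (Matrix.of fun i j : Fin 2 => if i.val + j.val + 1 = 2 then (1 : L) else 0)).Local v × (cmDatum L 1 (Matrix.of fun i j : Fin 1 => if i.val + j.val + 1 = 1 then (1 : L) else 0)).Local v)) = 1)
    {γH : (cmDatum L 2 (Matrix.of fun i j : Fin 2 => if i.val + j.val + 1 = 2 then (1 : L) else 0)).Local v × (cmDatum L 1 (Matrix.of fun i j : Fin 1 => if i.val + j.val + 1 = 1 then (1 : L) else 0)).Local v} (hreg : IsLocalGRegular L v γH)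
    [CompactSpace (Subgroup.centralizer ({γH.1} : Set ((cmDatum L 2 (Matrix.of fun i j : Fin 2 => if i.val + j.val + 1 = 2 then (1 : L) else 0)).Local v)))]
    (h2 : IsUnit (2 : 𝒪[(w.1.adicCompletion L)]))
    (hint : ∀ i : ℕ, ((((endoEmbLocal L v γH).val : GL (Fin 3) (LocalRing L v)).val.map (Pi.evalRingHom (fun w' : PlacesOver L v => w'.1.adicCompletion L) w)).charpoly.coeff i) ∈ 𝒪[(w.1.adicCompletion L)])
    (hirr : ¬ ∃ x : (w.1.adicCompletion L), (((((γH).1.val : GL (Fin 2) (UnitaryGroup.LocalRing L v)).val.map (Pi.evalRingHom (fun w' : PlacesOver L v => w'.1.adicCompletion L) w))).charpoly).IsRoot x)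
    (N : ℕ) (hN : Valued.v (((((γH).1.val : GL (Fin 2) (UnitaryGroup.LocalRing L v)).val.map (Pi.evalRingHom (fun w' : PlacesOver L v => w'.1.adicCompletion L) w))).trace ^ 2 - 4 * ((((γH).1.val : GL (Fin 2) (UnitaryGroup.LocalRing L v)).val.map (Pi.evalRingHom (fun w' : PlacesOver L v => w'.1.adicCompletion L) w))).det) = WithZero.exp (-((2 * N + 1 : ℕ) : ℤ)))
    {j : ℕ} (hj : 1 ≤ j) (hjN : j ≤ N) (ht2 : Valued.v (((((γH).1.val : GL (Fin 2) (UnitaryGroup.LocalRing L v)).val.map (Pi.evalRingHom (fun w' : PlacesOver L v => w'.1.adicCompletion L) w))).trace - 2) ≤ WithZero.exp (-(j : ℤ)))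
    (f : ((cmDatum L 2 (Matrix.of fun i j : Fin 2 => if i.val + j.val + 1 = 2 then (1 : L) else 0)).Local v × (cmDatum L 1 (Matrix.of fun i j : Fin 1 => if i.val + j.val + 1 = 1 then (1 : L) else 0)).Local v) → ℂ) (hfc : Continuous f) (hfK : Function.support f ⊆ ((((cmLocalIntegralLevel L 2 (Matrix.of fun i j : Fin 2 => if i.val + j.val + 1 = 2 then (1 : L) else 0) v).prod (cmLocalIntegralLevel L 1 (Matrix.of fun i j : Fin 1 => if i.val + j.val + 1 = 1 then (1 : L) else 0) v)) : Subgroup ((cmDatum L 2 (Matrix.of fun i j : Fin 2 => if i.val + j.val + 1 = 2 then (1 : L) else 0)).Local v × (cmDatum L 1 (Matrix.of fun i j : Fin 1 => if i.val + j.val + 1 = 1 then (1 : L) else 0)).Local v)) : Set ((cmDatum L 2 (Matrix.of fun i j : Fin 2 => if i.val + j.val + 1 = 2 then (1 : L) else 0)).Local v × (cmDatum L 1 (Matrix.of fun i j : Fin 1 => if i.val + j.val + 1 = 1 then (1 : L) else 0)).Local v)))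
    (hfinv : ∀ k ∈ (((cmLocalIntegralLevel L 2 (Matrix.of fun i j : Fin 2 => if i.val + j.val + 1 = 2 then (1 : L) else 0) v).prod (cmLocalIntegralLevel L 1 (Matrix.of fun i j : Fin 1 => if i.val + j.val + 1 = 1 then (1 : L) else 0) v)) : Subgroup ((cmDatum L 2 (Matrix.of fun i j : Fin 2 => if i.val + j.val + 1 = 2 then (1 : L) else 0)).Local v × (cmDatum L 1 (Matrix.of fun i j : Fin 1 => if i.val + j.val + 1 = 1 then (1 : L) else 0)).Local v)), ∀ x, f (k * x * k⁻¹) = f x)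
    (hf1 : ∀ x ∈ (((cmLocalIntegralLevel L 2 (Matrix.of fun i j : Fin 2 => if i.val + j.val + 1 = 2 then (1 : L) else 0) v).prod (cmLocalIntegralLevel L 1 (Matrix.of fun i j : Fin 1 => if i.val + j.val + 1 = 1 then (1 : L) else 0) v)) : Subgroup ((cmDatum L 2 (Matrix.of fun i j : Fin 2 => if i.val + j.val + 1 = 2 then (1 : L) else 0)).Local v × (cmDatum L 1 (Matrix.of fun i j : Fin 1 => if i.val + j.val + 1 = 1 then (1 : L) else 0)).Local v)), (∀ a b, valuation (w.1.adicCompletion L) ((((((localNonsplitEquiv (IsCMField.complexConj L) (Matrix.of fun i j : Fin 2 => if i.val + j.val + 1 = 2 then (1 : L) else 0) (IsCMField.complexConj_ne_one L) w hw) (x).1 : ↥(unitaryGroupOfForm (galAdicCompletionMap (L := L) (IsCMField.complexConj L) hw) (placeForm (Matrix.of fun i j : Fin 2 => if i.val + j.val + 1 = 2 then (1 : L) else 0) w.1))) : GL (Fin 2) (w.1.adicCompletion L)) : Matrix (Fin 2) (Fin 2) (w.1.adicCompletion L)) - 1) a b) ≤ valuation (w.1.adicCompletion L) ((toPlace v w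 (GaloisRepresentations.HeckeCharacter.uniformizer ↥(maximalRealSubfield L) v : v.adicCompletion ↥(maximalRealSubfield L))) ^ j)) → f x = 1)
    (hf0 : ∀ x ∈ (((cmLocalIntegralLevel L 2 (Matrix.of fun i j : Fin 2 => if i.val + j.val + 1 = 2 then (1 : L) else 0) v).prod (cmLocalIntegralLevel L 1 (Matrix.of fun i j : Fin 1 => if i.val + j.val + 1 = 1 then (1 : L) else 0) v)) : Subgroup ((cmDatum L 2 (Matrix.of fun i j : Fin 2 => if i.val + j.val + 1 = 2 then (1 : L) else 0)).Local v × (cmDatum L 1 (Matrix.of fun i j : Fin 1 => if i.val + j.val + 1 = 1 then (1 : L) else 0)).Local v)), ¬ (∀ a b, valuation (w.1.adicCompletion L) ((((((localNonsplitEquiv (IsCMField.complexConj L) (Matrix.of fun i j : Fin 2 => if i.val + j.val + 1 = 2 then (1 : L) else 0) (IsCMField.complexConj_ne_one L) w hw) (x).1 : ↥(unitaryGroupOfForm (galAdicCompletionMap (L := L) (IsCMField.complexConj L) hw) (placeForm (Matrix.of fun i j : Fin 2 => if i.val + j.val + 1 = 2 then (1 : L) else 0) w.1))) : GL (Fin 2)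 (w.1.adicCompletion L)) : Matrix (Fin 2) (Fin 2) (w.1.adicCompletion L)) - 1) a b) ≤ valuation (w.1.adicCompletion L) ((toPlace v w (GaloisRepresentations.HeckeCharacter.uniformizer ↥(maximalRealSubfield L) v : v.adicCompletion ↥(maximalRealSubfield L))) ^ j)) → f x = 0) :
    classOrbitalIntegral mH f (ConjClasses.mk γH) = ((∑ k ∈ range (N - j + 1), Nat.card (𝓞 ↥(maximalRealSubfield L) ⧸ v.asIdeal) ^ k : ℕ) : ℂ) := by
  have hϖv := Liu2021.LemD1IndexedNonVacuityInertCofinite.valued_toPlace_uniformizer_of_isUnramifiedIn L v hunr w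
  have hϖ := isUniformizingElement_of_v_eq hϖv
  have hc0 : (toPlace v w (GaloisRepresentations.HeckeCharacter.uniformizer ↥(maximalRealSubfield L) v : v.adicCompletion ↥(maximalRealSubfield L))) ^ j ≠ 0 := pow_ne_zero _ hϖ.ne_zero
  have hcv : valuation (w.1.adicCompletion L) ((toPlace v w (GaloisRepresentations.HeckeCharacter.uniformizer ↥(maximalRealSubfield L) v : v.adicCompletion ↥(maximalRealSubfield L))) ^ j) < 1 := by
    rw [← zpow_natCast, ← not_le, show (1 : ValueGroupWithZero (w.1.adicCompletion L)) = valuation (w.1.adicCompletion L) ((toPlace v w (GaloisRepresentations.HeckeCharacter.uniformizer ↥(maximalRealSubfield L) v : v.adicCompletion ↥(maximalRealSubfield L))) ^ (0 : ℤ)) by rw [zpow_zero, map_one],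
      valuation_zpow_le_valuation_zpow_iff hϖ]
    omega
  have key := classOrbitalIntegral_level_prod_eq_ncard_selfDual_level L v νH hmH hνH γH hreg w hw hunr hc0 hcv f hfc hfK hfinv hf1 hf0
  refine key.trans ?_
  rw [ncard_selfDualStable_level_antidiagTwo_eq_sum_of_not_exists_isRoot L v w hw hunr γH h2 hint hirr N hN hj hjN ht2]

set_option maxHeartbeats 400000 in
include hw in
/-- **THE TYPE-(2) LEVEL VALUE FOR ANY HAAR MEASURE: `Φ^st(γ_H, f) = ν_H(K_H) · phiHtwo q (N − j)`** — one class in the stable class (★ `…_of_not_exists_isRoot`),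
the Haar measure normalised on `K_H` (★ FILE A `exists_normalised`), §4 and `Σ_(k ≤ N−j) q^k = phiHtwo q (N − j)` (`geom_sum_eq`).  Law «C1» on the type-(2) torus in
T3′'s currency; `f` = the level-`ϖ_w^j` class function on `K_H` (★ F2-H spelling). [cite: Flicker1998UnitaryFL, §6 p. 97] [cite: Rogawski1990, §4.9 Prop. 4.9.1 (b) p. 55; §4.3 (4.3.1) p. 43] -/
theorem stableOrbitalIntegralRel_level_eq_mul_phiHtwo_of_not_exists_isRoot (hunr : Algebra.IsUnramifiedIn (𝓞 L) v.asIdeal)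
    {mH : OrbitalMeasureFamily ((cmDatum L 2 (Matrix.of fun i j : Fin 2 => if i.val + j.val + 1 = 2 then (1 : L) else 0)).Local v × (cmDatum L 1 (Matrix.of fun i j : Fin 1 => if i.val + j.val + 1 = 1 then (1 : L) else 0)).Local v)} (hmH : mH.IsCanonical (IsLocalGRegular L v) νH)
    {γH : (cmDatum L 2 (Matrix.of fun i j : Fin 2 => if i.val + j.val + 1 = 2 then (1 : L) else 0)).Local v × (cmDatum L 1 (Matrix.of fun i j : Fin 1 => if i.val + j.val + 1 = 1 then (1 : L) else 0)).Local v} (hreg : IsLocalGRegular L v γH)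
    [CompactSpace (Subgroup.centralizer ({γH.1} : Set ((cmDatum L 2 (Matrix.of fun i j : Fin 2 => if i.val + j.val + 1 = 2 then (1 : L) else 0)).Local v)))]
    (h2 : IsUnit (2 : 𝒪[(w.1.adicCompletion L)]))
    (hint : ∀ i : ℕ, ((((endoEmbLocal L v γH).val : GL (Fin 3) (LocalRing L v)).val.map (Pi.evalRingHom (fun w' : PlacesOver L v => w'.1.adicCompletion L) w)).charpoly.coeff i) ∈ 𝒪[(w.1.adicCompletion L)])
    (hirr : ¬ ∃ x : (w.1.adicCompletion L), (((((γH).1.val : GL (Fin 2) (UnitaryGroup.LocalRing L v)).val.map (Pi.evalRingHom (fun w' : PlacesOver L v => w'.1.adicCompletion L) w))).charpoly).IsRoot x)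
    (N : ℕ) (hN : Valued.v (((((γH).1.val : GL (Fin 2) (UnitaryGroup.LocalRing L v)).val.map (Pi.evalRingHom (fun w' : PlacesOver L v => w'.1.adicCompletion L) w))).trace ^ 2 - 4 * ((((γH).1.val : GL (Fin 2) (UnitaryGroup.LocalRing L v)).val.map (Pi.evalRingHom (fun w' : PlacesOver L v => w'.1.adicCompletion L) w))).det) = WithZero.exp (-((2 * N + 1 : ℕ) : ℤ)))
    {j : ℕ} (hj : 1 ≤ j) (hjN : j ≤ N) (ht2 : Valued.v (((((γH).1.val : GL (Fin 2) (UnitaryGroup.LocalRing L v)).val.map (Pi.evalRingHom (fun w' : PlacesOver L v => w'.1.adicCompletion L) w))).trace - 2) ≤ WithZero.exp (-(j : ℤ)))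
    (f : ((cmDatum L 2 (Matrix.of fun i j : Fin 2 => if i.val + j.val + 1 = 2 then (1 : L) else 0)).Local v × (cmDatum L 1 (Matrix.of fun i j : Fin 1 => if i.val + j.val + 1 = 1 then (1 : L) else 0)).Local v) → ℂ) (hfc : Continuous f) (hfK : Function.support f ⊆ ((((cmLocalIntegralLevel L 2 (Matrix.of fun i j : Fin 2 => if i.val + j.val + 1 = 2 then (1 : L) else 0) v).prod (cmLocalIntegralLevel L 1 (Matrix.of fun i j : Fin 1 => if i.val + j.val + 1 = 1 then (1 : L) else 0) v)) : Subgroup ((cmDatum L 2 (Matrix.of fun i j : Fin 2 => if i.val + j.val + 1 = 2 then (1 : L) else 0)).Local v × (cmDatum L 1 (Matrix.of fun i j : Fin 1 => if i.val + j.val + 1 = 1 then (1 : L) else 0)).Local v)) : Set ((cmDatum L 2 (Matrix.of fun i j : Fin 2 => if i.val + j.val + 1 = 2 then (1 : L) else 0)).Local v × (cmDatum L 1 (Matrix.of fun i j : Fin 1 => if i.val + j.val + 1 = 1 then (1 : L) else 0)).Local v)))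
    (hfinv : ∀ k ∈ (((cmLocalIntegralLevel L 2 (Matrix.of fun i j : Fin 2 => if i.val + j.val + 1 = 2 then (1 : L) else 0) v).prod (cmLocalIntegralLevel L 1 (Matrix.of fun i j : Fin 1 => if i.val + j.val + 1 = 1 then (1 : L) else 0) v)) : Subgroup ((cmDatum L 2 (Matrix.of fun i j : Fin 2 => if i.val + j.val + 1 = 2 then (1 : L) else 0)).Local v × (cmDatum L 1 (Matrix.of fun i j : Fin 1 => if i.val + j.val + 1 = 1 then (1 : L) else 0)).Local v)), ∀ x, f (k * x * k⁻¹) = f x)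
    (hf1 : ∀ x ∈ (((cmLocalIntegralLevel L 2 (Matrix.of fun i j : Fin 2 => if i.val + j.val + 1 = 2 then (1 : L) else 0) v).prod (cmLocalIntegralLevel L 1 (Matrix.of fun i j : Fin 1 => if i.val + j.val + 1 = 1 then (1 : L) else 0) v)) : Subgroup ((cmDatum L 2 (Matrix.of fun i j : Fin 2 => if i.val + j.val + 1 = 2 then (1 : L) else 0)).Local v × (cmDatum L 1 (Matrix.of fun i j : Fin 1 => if i.val + j.val + 1 = 1 then (1 : L) else 0)).Local v)), (∀ a b, valuation (w.1.adicCompletion L) ((((((localNonsplitEquiv (IsCMField.complexConj L) (Matrix.of fun i j : Fin 2 => if i.val + j.val + 1 = 2 then (1 : L) else 0) (IsCMField.complexConj_ne_one L) w hw) (x).1 : ↥(unitaryGroupOfForm (galAdicCompletionMap (L := L) (IsCMField.complexConj L) hw) (placeForm (Matrix.of fun i j : Fin 2 => if i.val + j.val + 1 = 2 then (1 : L) else 0) w.1))) : GL (Fin 2) (w.1.adicCompletion L)) : Matrix (Fin 2) (Fin 2) (w.1.adicCompletion L)) - 1) a b) ≤ valuation (w.1.adicCompletion L) ((toPlace v w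 (GaloisRepresentations.HeckeCharacter.uniformizer ↥(maximalRealSubfield L) v : v.adicCompletion ↥(maximalRealSubfield L))) ^ j)) → f x = 1)
    (hf0 : ∀ x ∈ (((cmLocalIntegralLevel L 2 (Matrix.of fun i j : Fin 2 => if i.val + j.val + 1 = 2 then (1 : L) else 0) v).prod (cmLocalIntegralLevel L 1 (Matrix.of fun i j : Fin 1 => if i.val + j.val + 1 = 1 then (1 : L) else 0) v)) : Subgroup ((cmDatum L 2 (Matrix.of fun i j : Fin 2 => if i.val + j.val + 1 = 2 then (1 : L) else 0)).Local v × (cmDatum L 1 (Matrix.of fun i j : Fin 1 => if i.val + j.val + 1 = 1 then (1 : L) else 0)).Local v)), ¬ (∀ a b, valuation (w.1.adicCompletion L) ((((((localNonsplitEquiv (IsCMField.complexConj L) (Matrix.of fun i j : Fin 2 => if i.val + j.val + 1 = 2 then (1 : L) else 0) (IsCMField.complexConj_ne_one L) w hw) (x).1 : ↥(unitaryGroupOfForm (galAdicCompletionMap (L := L) (IsCMField.complexConj L) hw) (placeForm (Matrix.of fun i j : Fin 2 => if i.val + j.val + 1 = 2 then (1 : L) else 0) w.1))) : GL (Fin 2)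 (w.1.adicCompletion L)) : Matrix (Fin 2) (Fin 2) (w.1.adicCompletion L)) - 1) a b) ≤ valuation (w.1.adicCompletion L) ((toPlace v w (GaloisRepresentations.HeckeCharacter.uniformizer ↥(maximalRealSubfield L) v : v.adicCompletion ↥(maximalRealSubfield L))) ^ j)) → f x = 0) :
    stableOrbitalIntegralRel (IsLocalStablyConjH L v) mH f γH =
      (νH.real ((((cmLocalIntegralLevel L 2 (Matrix.of fun i j : Fin 2 => if i.val + j.val + 1 = 2 then (1 : L) else 0) v).prod (cmLocalIntegralLevel L 1 (Matrix.of fun i j : Fin 1 => if i.val + j.val + 1 = 1 then (1 : L) else 0) v)) : Subgroup ((cmDatum L 2 (Matrix.of fun i j : Fin 2 => if i.val + j.val + 1 = 2 then (1 : L) else 0)).Local v × (cmDatum L 1 (Matrix.of fun i j : Fin 1 => if i.val + j.val + 1 = 1 then (1 : L) else 0)).Local v)) : Set ((cmDatum L 2 (Matrix.of fun i j : Fin 2 => if i.val + j.val + 1 = 2 then (1 : L) else 0)).Local v × (cmDatum L 1 (Matrix.of fun i j : Fin 1 => if i.val + j.val + 1 = 1 then (1 : L) else 0)).Local v)) : ℂ)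 * ((Flicker1998.phiHtwo (Ideal.absNorm v.asIdeal) (N - j) : ℚ) : ℂ) := by
  obtain ⟨hKc, hKi⟩ := isCompact_and_interior_nonempty_prod_cmLocalIntegralLevel L v
  obtain ⟨ν₁, hν₁, hν₁', m₁, hm₁, h1, -, hst⟩ := hmH.exists_normalised hKc hKi
  rw [hst]
  congr 1
  rw [stableOrbitalIntegralRel_eq_classOrbitalIntegral_of_not_exists_isRoot L v w hw m₁ f hirr,
    classOrbitalIntegral_level_eq_sum_of_not_exists_isRoot L v w hw ν₁ hunr hm₁ h1 hreg h2 hint hirr N hN hj hjN ht2 f hfc hfK hfinv hf1 hf0,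
    Flicker1998.phiHtwo, Ideal.absNorm_apply, Submodule.cardQuot_apply]
  have hq2 := two_le_natCard_quotient L v
  have hq1 : ((Nat.card (𝓞 ↥(maximalRealSubfield L) ⧸ v.asIdeal) : ℚ)) ≠ 1 := by exact_mod_cast (show Nat.card (𝓞 ↥(maximalRealSubfield L) ⧸ v.asIdeal) ≠ 1 by omega)
  rw [← geom_sum_eq hq1 (N - j + 1)]
  push_cast
  rfl

set_option maxHeartbeats 400000 in
include hw in
/-- **THE TYPE-(2) UNIT VALUE FOR ANY HAAR MEASURE: `Φ^st(γ_H, 1_{K_H}) = ν_H(K_H) · phiHtwo q N`** — ★ `classOrbitalIntegral_indicator_eq_phiHtwo_of_not_exists_isRoot`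
(`ν_H(K_H) = 1`) with one class (★ `…_of_not_exists_isRoot`) and §1 of ★ FILE A. [cite: Flicker1998UnitaryFL, §6 p. 97] [cite: Rogawski1990, §4.9 Prop. 4.9.1 (b) p. 55; §4.3 (4.3.1) p. 43] -/
theorem stableOrbitalIntegralRel_indicator_eq_mul_phiHtwo_of_not_exists_isRoot (hunr : Algebra.IsUnramifiedIn (𝓞 L) v.asIdeal)
    {mH : OrbitalMeasureFamily ((cmDatum L 2 (Matrix.of fun i j : Fin 2 => if i.val + j.val + 1 = 2 then (1 : L) else 0)).Local v × (cmDatum L 1 (Matrix.of fun i j : Fin 1 => if i.val + j.val + 1 = 1 then (1 : L) else 0)).Local v)} (hmH : mH.IsCanonical (IsLocalGRegular L v) νH)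
    {γH : (cmDatum L 2 (Matrix.of fun i j : Fin 2 => if i.val + j.val + 1 = 2 then (1 : L) else 0)).Local v × (cmDatum L 1 (Matrix.of fun i j : Fin 1 => if i.val + j.val + 1 = 1 then (1 : L) else 0)).Local v} (hreg : IsLocalGRegular L v γH)
    [CompactSpace (Subgroup.centralizer ({γH.1} : Set ((cmDatum L 2 (Matrix.of fun i j : Fin 2 => if i.val + j.val + 1 = 2 then (1 : L) else 0)).Local v)))]
    (h2 : IsUnit (2 : 𝒪[(w.1.adicCompletion L)]))
    (hint : ∀ i : ℕ, ((((endoEmbLocal L v γH).val : GL (Fin 3) (LocalRing L v)).val.map (Pi.evalRingHom (fun w' : PlacesOver L v => w'.1.adicCompletion L) w)).charpoly.coeff i) ∈ 𝒪[(w.1.adicCompletion L)])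
    (hirr : ¬ ∃ x : (w.1.adicCompletion L), (((((γH).1.val : GL (Fin 2) (UnitaryGroup.LocalRing L v)).val.map (Pi.evalRingHom (fun w' : PlacesOver L v => w'.1.adicCompletion L) w))).charpoly).IsRoot x)
    (N : ℕ) (hN : Valued.v (((((γH).1.val : GL (Fin 2) (UnitaryGroup.LocalRing L v)).val.map (Pi.evalRingHom (fun w' : PlacesOver L v => w'.1.adicCompletion L) w))).trace ^ 2 - 4 * ((((γH).1.val : GL (Fin 2) (UnitaryGroup.LocalRing L v)).val.map (Pi.evalRingHom (fun w' : PlacesOver L v => w'.1.adicCompletion L) w))).det) = WithZero.exp (-((2 * N + 1 : ℕ) : ℤ))) :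
    stableOrbitalIntegralRel (IsLocalStablyConjH L v) mH (((((cmLocalIntegralLevel L 2 (Matrix.of fun i j : Fin 2 => if i.val + j.val + 1 = 2 then (1 : L) else 0) v).prod (cmLocalIntegralLevel L 1 (Matrix.of fun i j : Fin 1 => if i.val + j.val + 1 = 1 then (1 : L) else 0) v)) : Subgroup ((cmDatum L 2 (Matrix.of fun i j : Fin 2 => if i.val + j.val + 1 = 2 then (1 : L) else 0)).Local v × (cmDatum L 1 (Matrix.of fun i j : Fin 1 => if i.val + j.val + 1 = 1 then (1 : L) else 0)).Local v)) : Set ((cmDatum L 2 (Matrix.of fun i j : Fin 2 => if i.val + j.val + 1 = 2 then (1 : L) else 0)).Local v × (cmDatum L 1 (Matrix.of fun i j : Fin 1 => if i.val + j.val + 1 = 1 then (1 : L) else 0)).Local v)).indicator fun _ => (1 : ℂ)) γH =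
      (νH.real ((((cmLocalIntegralLevel L 2 (Matrix.of fun i j : Fin 2 => if i.val + j.val + 1 = 2 then (1 : L) else 0) v).prod (cmLocalIntegralLevel L 1 (Matrix.of fun i j : Fin 1 => if i.val + j.val + 1 = 1 then (1 : L) else 0) v)) : Subgroup ((cmDatum L 2 (Matrix.of fun i j : Fin 2 => if i.val + j.val + 1 = 2 then (1 : L) else 0)).Local v × (cmDatum L 1 (Matrix.of fun i j : Fin 1 => if i.val + j.val + 1 = 1 then (1 : L) else 0)).Local v)) : Set ((cmDatum L 2 (Matrix.of fun i j : Fin 2 => if i.val + j.val + 1 = 2 then (1 : L) else 0)).Local v × (cmDatum L 1 (Matrix.of fun i j : Fin 1 => if i.val + j.val + 1 = 1 then (1 : L) else 0)).Local v)) : ℂ) * ((Flicker1998.phiHtwo (Ideal.absNorm v.asIdeal) N : ℚ) : ℂ) := by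
  obtain ⟨hKc, hKi⟩ := isCompact_and_interior_nonempty_prod_cmLocalIntegralLevel L v
  obtain ⟨ν₁, hν₁, hν₁', m₁, hm₁, h1, -, hst⟩ := hmH.exists_normalised hKc hKi
  rw [hst, stableOrbitalIntegralRel_eq_classOrbitalIntegral_of_not_exists_isRoot L v w hw m₁ _ hirr,
    classOrbitalIntegral_indicator_eq_phiHtwo_of_not_exists_isRoot L v w hw ν₁ hunr hm₁ h1 hreg h2 hint hirr N hN]

end Head

end Literature.NumberTheory.Automorphic.UnitaryGroup

end
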